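/-
Copyright (c) 2026 the pub-hodgecm-mathlib formalisation cell (harness21).  Prover seat hodgecm-mathlib-K2Liu-p13 (g4), Track B «K2-LIT»,
#184♮ = hLiu418 = `stmt-HodgeConjecture-24832`; ROAD Φ (RULING «M-156n»), #41 TOP (★ ed. 13 consumes ★ p861823 `exists_bigCell_continuation_cm_of_faces` by name) — the SAME
head with the Euler face a FINITE SUM of pure tensors (the honest shape of the `T`-block after (E6′) «away purity as a flat family» + ★ p862082 Fubini: a standard `K`-finite
section is a SUM `Σ_i A_i ⊗ ⊗_v b_{i,v}`, not one tensor), so the TOP's next edition has the socket the END FILE will actually pay.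
THEOREMS ONLY (no `def`, no `instance`, no named-fact hypothesis, no `sorry`).
-/
import Summits.HodgeConjecture.HodgeConjecture.Theorems.K2LiuBigCellContinuationOfFaces     -- ★ p861823 (single-tensor heads) + its imports (★ p861688, ★ p861729, ★ p861784, ★ p861474)
import HarnessLib

/-!
# Crux `HLiu418`, ROAD Φ, organ Φ8 (row G6): THE BIG-CELL CONTINUATION LETTER FROM A FINITE SUM OF PURE-TENSOR FACES

Cell `hodgecm-mathlib`, crux item hLiu418 = `stmt-HodgeConjecture-24832` (helper lane, count-neutral).  ★ p861823 took, per `κ ∈ K`, ONE product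
`A κ s · ∏_{v∈TF κ}(c κ v s · N κ v s)`; the Euler face of a `K`-finite standard section is a finite SUM of such products (indices `i ∈ I κ`, the pure tensors of the
`T`-slice, ★ `K2LiuStdSectionAwayPurity.exists_awayPurity` ∕ (E6′)).  This file restates the three heads with `Σ_{i∈I κ}`:
* §1 **`exists_pointContinuation_of_facesSum`** — point assembly: `B s = Σ_i A i s · ∏_v (c v s · N i v s)` on `c₀ < re s`, `A i`, `c v` holomorphic on `{0<re}`, `N i v` A7-AllS0-regular
  ⟹ `∃ Eκ` holomorphic on `{0<re}`, `= B` on `c₀ < re s` (★ p861729 bridge + `DifferentiableOn.fun_sum`).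
* §2 **`exists_bigCell_continuation_of_facesSum`** (generic scalar `a`) and **`exists_bigCell_continuation_cm_of_facesSum`** (`n = 2`, `a = b^S∕a^S`, faces at `S ∪ P κ`,
  ★ p861784 change of set) ⟹ `(E, hEd, hEeq)` in the TOP's bytes (★ p861688 `exists_continuation_of_isStandardSectionFamily_pointwise`).
* §3 **`exists_bigCell_termPackage_cm_of_facesSum`** — ★ `exists_bigCell_termPackage_cm'` with the letter discharged to the summed faces.
Per `κ` the by-value surface is: `I κ : Finset ι'`, `TF κ : Finset ι`, `q`, arch blocks `A κ i`, scalars `c κ v` (★ E7′∕E7″∕OfRecord: `aNorm_v` at `v ∈ S_ε`, `m_v` at `v ∈ P κ`),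
normalised local values `N κ i v` (★ A7-AllS0), and the Euler-face identity `hB` (END FILE: ★ E3 + ★ Fubini + (E4) + (E6′) + (E8)).
Sources: [Tan1999, §3]; [KudlaSweet1997, §1]; [HarrisKudlaSweet1996, §1 (1.15)–(1.17), §6 (6.14)–(6.16)]; [Garrett2018, §3.10–§3.12]; [MoeglinWaldspurger1995, II.1.7, IV.1.8].
HONEST LABEL.  Helper lemmas, count-neutral; `HC_CM` is proved only modulo the 7 printed citations (2 remaining named inputs:
hLiu418 = `stmt-HodgeConjecture-24832`, h413 = `stmt-HodgeConjecture-24833`) until rung 0 closes.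
-/

set_option autoImplicit false
set_option linter.dupNamespace false -- the mandated namespace repeats `HodgeConjecture.HodgeConjecture`

noncomputable section

open scoped Matrix NNReal ENNReal
open NumberField IsDedekindDomain MeasureTheory MeasureTheory.Measure Metric

namespace Summit.HodgeConjecture.HodgeConjecture.Cruxes.HLiu418.K2LiuBigCellContinuationOfFacesSum

open Literature.NumberTheory.GelbartRogawski1991.AdaptedBlocks
open Literature.NumberTheory.Automorphic Literature.NumberTheory.Automorphic.UnitaryGroup
open Literature.NumberTheory.GelbartRogawski1991 Literature.NumberTheory.GelbartRogawski1991.GRConstruction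
open Literature.NumberTheory.K2Lit.SiegelDoubled Literature.NumberTheory.GaloisRepresentations Literature.NumberTheory.LFunctions
open UnitaryDualPair
open Summit.HodgeConjecture.HodgeConjecture.Cruxes.HLiu418.K2LiuQRationalDefs (IsQRationalRegularAt)
open Summit.HodgeConjecture.HodgeConjecture.Cruxes.HLiu418.K2LiuBigCellContinuationReduction (exists_continuation_of_isStandardSectionFamily_pointwise)
open Summit.HodgeConjecture.HodgeConjecture.Cruxes.HLiu418.K2LiuBigCellContinuationPointLetters (differentiableOn_re_pos_of_forall_isQRationalRegularAt)
open Summit.HodgeConjecture.HodgeConjecture.Cruxes.HLiu418.K2LiuSiegelIntertwiningScalarChangeOfSet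
  (invScalar_eq_finsetProd_mul_cm differentiableOn_finsetProd_inv_localScalar_cm)
open Summit.HodgeConjecture.HodgeConjecture.Cruxes.HLiu418.K2LiuSiegelEisensteinBigCellTermPackageCM (exists_bigCell_termPackage_cm')

/-! ## §1 Point assembly from a finite sum of pure-tensor faces -/

/-- **THE BIG-CELL CONTINUATION AT A POINT FROM A FINITE SUM OF FACES.**  Indices `I` (pure tensors) and `TF` (bad finite places, `q v ≠ 0`); blocks `A i` and scalars `c v`
holomorphic on `{0 < re}`; normalised local values `N i v` `q_v`-rational regular at every `s₀` with `0 < re s₀`; the Euler-face identity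
`B s = Σ_{i∈I} A i s · ∏_{v∈TF} (c v s · N i v s)` on `c₀ < re s`.  Then `B` continues holomorphically to `{0 < re}`. [cite: Tan1999, §3] [cite: KudlaSweet1997, §1] -/
theorem exists_pointContinuation_of_facesSum {ι ι' : Type*} (I : Finset ι') (TF : Finset ι) (q : ι → ℕ) (hq : ∀ v ∈ TF, q v ≠ 0) (c₀ : ℝ)
    (A : ι' → ℂ → ℂ) (hA : ∀ i ∈ I, DifferentiableOn ℂ (A i) {s : ℂ | 0 < s.re})
    (c : ι → ℂ → ℂ) (hc : ∀ v ∈ TF, DifferentiableOn ℂ (c v) {s : ℂ | 0 < s.re})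
    (N : ι' → ι → ℂ → ℂ) (hN : ∀ i ∈ I, ∀ v ∈ TF, ∀ s₀ : ℂ, 0 < s₀.re → IsQRationalRegularAt (q v) s₀ (N i v))
    (B : ℂ → ℂ) (hB : ∀ s : ℂ, c₀ < s.re → B s = ∑ i ∈ I, A i s * ∏ v ∈ TF, (c v s * N i v s)) :
    ∃ Eκ : ℂ → ℂ, DifferentiableOn ℂ Eκ {s : ℂ | 0 < s.re} ∧ ∀ s : ℂ, c₀ < s.re → Eκ s = B s :=
  ⟨fun s => ∑ i ∈ I, A i s * ∏ v ∈ TF, (c v s * N i v s),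
    DifferentiableOn.fun_sum fun i hi => (hA i hi).mul (DifferentiableOn.fun_finsetProd fun v hv =>
      (hc v hv).mul (differentiableOn_re_pos_of_forall_isQRationalRegularAt (hq v hv) (hN i hi v hv))),
    fun s hs => (hB s hs).symm⟩

/-! ## §2 The letter `(E, hEd, hEeq)` from summed faces at the points of `K` -/

variable (L : Type) [Field L] [NumberField L] [IsCMField L]
variable {N₀ M₀ n : ℕ} (e : Fin N₀ × Fin M₀ ≃ Fin n)
  (dV : Fin N₀ → L) (hdV : ∀ i, IsCMField.complexConj L (dV i) = dV i)
  (dW : Fin M₀ → L) (hdW : ∀ i, IsCMField.complexConj L (dW i) = dW i)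

/-- **THE BIG-CELL CONTINUATION LETTER FROM SUMMED FACES** (generic `n`, any scalar `a`, any `χ`; only `hstd`): per `κ ∈ K` the Euler-face identity
`a s · M(s)f_s(κ) = Σ_{i∈I κ} A κ i s · ∏_{v∈TF κ}(c κ v s · N κ i v s)` on `c₀ < re s` with the faces' regularity ⟹ `(E, hEd, hEeq)`.
[cite: Tan1999, §3] [cite: KudlaSweet1997, §1] [cite: Garrett2018, §3.10–§3.12] -/
theorem exists_bigCell_continuation_of_facesSum (hdV0 : ∀ i, dV i ≠ 0) (hdW0 : ∀ i, dW i ≠ 0) (𝒦 : IwasawaDatum L e dV hdV dW hdW)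
    [MeasurableSpace (unipDelta L e dV hdV dW hdW)] [BorelSpace (unipDelta L e dV hdV dW hdW)]
    (νN : Measure (unipDelta L e dV hdV dW hdW)) [νN.IsHaarMeasure] (χ : HeckeCharacter L) (c₀ : ℝ)
    {f : ℂ → HA L e dV hdV dW hdW → ℂ} (hstd : IsStandardSectionFamily 𝒦 χ f) (a : ℂ → ℂ)
    {ι ι' : Type*} (I : ↥𝒦.K → Finset ι') (TF : ↥𝒦.K → Finset ι) (q : ι → ℕ) (hq : ∀ κ, ∀ v ∈ TF κ, q v ≠ 0)
    (A : ↥𝒦.K → ι' → ℂ → ℂ) (hA : ∀ κ, ∀ i ∈ I κ, DifferentiableOn ℂ (A κ i) {s : ℂ | 0 < s.re})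
    (c : ↥𝒦.K → ι → ℂ → ℂ) (hc : ∀ κ, ∀ v ∈ TF κ, DifferentiableOn ℂ (c κ v) {s : ℂ | 0 < s.re})
    (N : ↥𝒦.K → ι' → ι → ℂ → ℂ) (hN : ∀ κ, ∀ i ∈ I κ, ∀ v ∈ TF κ, ∀ s₀ : ℂ, 0 < s₀.re → IsQRationalRegularAt (q v) s₀ (N κ i v))
    (hB : ∀ (κ : ↥𝒦.K) (s : ℂ), c₀ < s.re →
      a s * intertwiningDelta L e dV hdV dW hdW νN (f s) (κ : HA L e dV hdV dW hdW) = ∑ i ∈ I κ, A κ i s * ∏ v ∈ TF κ, (c κ v s * N κ i v s)) :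
    ∃ E : ℂ → HA L e dV hdV dW hdW → ℂ,
      (∀ x : HA L e dV hdV dW hdW, DifferentiableOn ℂ (fun s : ℂ => E s x) {s : ℂ | 0 < s.re}) ∧
      (∀ (s : ℂ) (x : HA L e dV hdV dW hdW), c₀ < s.re → E s x = a s * intertwiningDelta L e dV hdV dW hdW νN (f s) x) :=
  exists_continuation_of_isStandardSectionFamily_pointwise L e dV hdV dW hdW hdV0 hdW0 𝒦 νN χ c₀ hstd a fun k hk =>
    exists_pointContinuation_of_facesSum (I ⟨k, hk⟩) (TF ⟨k, hk⟩) q (hq ⟨k, hk⟩) c₀ (A ⟨k, hk⟩) (hA ⟨k, hk⟩) (c ⟨k, hk⟩) (hc ⟨k, hk⟩) (N ⟨k, hk⟩) (hN ⟨k, hk⟩)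
      (fun s => a s * intertwiningDelta L e dV hdV dW hdW νN (f s) k) (hB ⟨k, hk⟩)

/-- **THE #41 TOP's LETTER AT THE K2_Liu FRAME FROM SUMMED FACES** (`n = 2`, `a := b^S∕a^S`; faces at `S ∪ P κ`, ★ p861784 moves the set; its finite correction
`∏_{v∈Pκ} c_v⁻¹` is holomorphic on `{0<re}` and multiplies every arch block). [cite: Tan1999, §3] [cite: KudlaSweet1997, §1] [cite: HarrisKudlaSweet1996, §6 (6.14)–(6.16)] -/
theorem exists_bigCell_continuation_cm_of_facesSum (hn : n = 2) (hdV0 : ∀ i, dV i ≠ 0) (hdW0 : ∀ i, dW i ≠ 0) (𝒦 : IwasawaDatum L e dV hdV dW hdW)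
    [MeasurableSpace (unipDelta L e dV hdV dW hdW)] [BorelSpace (unipDelta L e dV hdV dW hdW)]
    (νN : Measure (unipDelta L e dV hdV dW hdW)) [νN.IsHaarMeasure] (χ : HeckeCharacter L)
    {f : ℂ → HA L e dV hdV dW hdW → ℂ} (hstd : IsStandardSectionFamily 𝒦 χ f)
    (S : Set (HeightOneSpectrum (𝓞 ↥(maximalRealSubfield L))))
    (P : ↥𝒦.K → Finset (HeightOneSpectrum (𝓞 ↥(maximalRealSubfield L)))) (hPS : ∀ κ, ∀ v ∈ P κ, v ∉ S)
    {ι ι' : Type*} (I : ↥𝒦.K → Finset ι') (TF : ↥𝒦.K → Finset ι) (q : ι → ℕ) (hq : ∀ κ, ∀ v ∈ TF κ, q v ≠ 0)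
    (A : ↥𝒦.K → ι' → ℂ → ℂ) (hA : ∀ κ, ∀ i ∈ I κ, DifferentiableOn ℂ (A κ i) {s : ℂ | 0 < s.re})
    (c : ↥𝒦.K → ι → ℂ → ℂ) (hc : ∀ κ, ∀ v ∈ TF κ, DifferentiableOn ℂ (c κ v) {s : ℂ | 0 < s.re})
    (N : ↥𝒦.K → ι' → ι → ℂ → ℂ) (hN : ∀ κ, ∀ i ∈ I κ, ∀ v ∈ TF κ, ∀ s₀ : ℂ, 0 < s₀.re → IsQRationalRegularAt (q v) s₀ (N κ i v))
    (hB : ∀ (κ : ↥𝒦.K) (s : ℂ), 1 < s.re →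
      (partialStandardL (S ∪ (↑(P κ) : Set (HeightOneSpectrum (𝓞 ↥(maximalRealSubfield L))))) (fun _ => {1}) (2 * s + 1) *
            partialStandardL (S ∪ (↑(P κ) : Set (HeightOneSpectrum (𝓞 ↥(maximalRealSubfield L))))) (fun v => {(quadraticHeckeCharCM L).valueAtUniformizer v}) (2 * s + 2)) /
          (partialStandardL (S ∪ (↑(P κ) : Set (HeightOneSpectrum (𝓞 ↥(maximalRealSubfield L))))) (fun _ => {1}) (2 * s) *
            partialStandardL (S ∪ (↑(P κ) : Set (HeightOneSpectrum (𝓞 ↥(maximalRealSubfield L))))) (fun v => {(quadraticHeckeCharCM L).valueAtUniformizer v}) (2 * s - 1)) *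
        intertwiningDelta L e dV hdV dW hdW νN (f s) (κ : HA L e dV hdV dW hdW) = ∑ i ∈ I κ, A κ i s * ∏ v ∈ TF κ, (c κ v s * N κ i v s)) :
    ∃ E : ℂ → HA L e dV hdV dW hdW → ℂ,
      (∀ x : HA L e dV hdV dW hdW, DifferentiableOn ℂ (fun s : ℂ => E s x) {s : ℂ | 0 < s.re}) ∧
      (∀ (s : ℂ) (x : HA L e dV hdV dW hdW), (n : ℝ) / 2 < s.re →
        E s x = (partialStandardL S (fun _ => {1}) (2 * s + 1) * partialStandardL S (fun v => {(quadraticHeckeCharCM L).valueAtUniformizer v}) (2 * s + 2)) /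
            (partialStandardL S (fun _ => {1}) (2 * s) * partialStandardL S (fun v => {(quadraticHeckeCharCM L).valueAtUniformizer v}) (2 * s - 1)) *
          intertwiningDelta L e dV hdV dW hdW νN (f s) x) := by
  have hn2 : (n : ℝ) / 2 = 1 := by rw [hn]; norm_num
  refine exists_bigCell_continuation_of_facesSum L e dV hdV dW hdW hdV0 hdW0 𝒦 νN χ ((n : ℝ) / 2) hstd _ I TF q hq
    (fun κ i s => (∏ v ∈ P κ, (((1 - (v.residueCard : ℂ) ^ (-(2 * s))) * (1 - (quadraticHeckeCharCM L).valueAtUniformizer v * (v.residueCard : ℂ) ^ (-(2 * s - 1)))) /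
        ((1 - (v.residueCard : ℂ) ^ (-(2 * s + 1))) * (1 - (quadraticHeckeCharCM L).valueAtUniformizer v * (v.residueCard : ℂ) ^ (-(2 * s + 2)))))) * A κ i s)
    (fun κ i hi => ((differentiableOn_finsetProd_inv_localScalar_cm L (P κ)).mono fun s (hs : 0 < s.re) => ?_).mul (hA κ i hi)) c hc N hN fun κ s hs => ?_
  · show -(1 / 2 : ℝ) < s.re
    linarith
  · have hs1 : 1 < s.re := by rw [hn2] at hs; exact hs
    rw [invScalar_eq_finsetProd_mul_cm L S (P κ) (hPS κ) hs1, mul_assoc, hB κ s hs1, Finset.mul_sum]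
    refine Finset.sum_congr rfl fun i _ => ?_
    rw [← mul_assoc]

/-! ## §3 The TOP's kind-0 big-cell term package from summed faces -/

/-- **THE BIG-CELL TERM PACKAGE OF THE #41 TOP AT THE K2_Liu FRAME, FROM SUMMED FACES** — ★ `exists_bigCell_termPackage_cm'` with `(E, hEd, hEeq)` discharged by §2.
[cite: Tan1999, §3] [cite: KudlaSweet1997, §1] [cite: Harris2007, (1.3.4) p. 92] [cite: Garrett2018, §3.12] -/
theorem exists_bigCell_termPackage_cm_of_facesSum (hn : n = 2) (hdV0 : ∀ i, dV i ≠ 0) (hdW0 : ∀ i, dW i ≠ 0) (𝒦 : IwasawaDatum L e dV hdV dW hdW)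
    [MeasurableSpace (unipDelta L e dV hdV dW hdW)] [BorelSpace (unipDelta L e dV hdV dW hdW)]
    (νN : Measure (unipDelta L e dV hdV dW hdW)) [νN.IsHaarMeasure] (χ : HeckeCharacter L) (hχ : χ.IsUnitary)
    (f : ℂ → HA L e dV hdV dW hdW → ℂ) (hstd : IsStandardSectionFamily 𝒦 χ f) (hcont : ∀ s, Continuous (f s))
    {S : Set (HeightOneSpectrum (𝓞 ↥(maximalRealSubfield L)))} (hS : S.Finite) (hur : ∀ v ∉ S, (quadraticHeckeCharCM L).IsUnramifiedAt v)
    (P : ↥𝒦.K → Finset (HeightOneSpectrum (𝓞 ↥(maximalRealSubfield L)))) (hPS : ∀ κ, ∀ v ∈ P κ, v ∉ S)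
    {ι ι' : Type*} (I : ↥𝒦.K → Finset ι') (TF : ↥𝒦.K → Finset ι) (q : ι → ℕ) (hq : ∀ κ, ∀ v ∈ TF κ, q v ≠ 0)
    (A : ↥𝒦.K → ι' → ℂ → ℂ) (hA : ∀ κ, ∀ i ∈ I κ, DifferentiableOn ℂ (A κ i) {s : ℂ | 0 < s.re})
    (c : ↥𝒦.K → ι → ℂ → ℂ) (hc : ∀ κ, ∀ v ∈ TF κ, DifferentiableOn ℂ (c κ v) {s : ℂ | 0 < s.re})
    (N : ↥𝒦.K → ι' → ι → ℂ → ℂ) (hN : ∀ κ, ∀ i ∈ I κ, ∀ v ∈ TF κ, ∀ s₀ : ℂ, 0 < s₀.re → IsQRationalRegularAt (q v) s₀ (N κ i v))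
    (hB : ∀ (κ : ↥𝒦.K) (s : ℂ), 1 < s.re →
      (partialStandardL (S ∪ (↑(P κ) : Set (HeightOneSpectrum (𝓞 ↥(maximalRealSubfield L))))) (fun _ => {1}) (2 * s + 1) *
            partialStandardL (S ∪ (↑(P κ) : Set (HeightOneSpectrum (𝓞 ↥(maximalRealSubfield L))))) (fun v => {(quadraticHeckeCharCM L).valueAtUniformizer v}) (2 * s + 2)) /
          (partialStandardL (S ∪ (↑(P κ) : Set (HeightOneSpectrum (𝓞 ↥(maximalRealSubfield L))))) (fun _ => {1}) (2 * s) *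
            partialStandardL (S ∪ (↑(P κ) : Set (HeightOneSpectrum (𝓞 ↥(maximalRealSubfield L))))) (fun v => {(quadraticHeckeCharCM L).valueAtUniformizer v}) (2 * s - 1)) *
        intertwiningDelta L e dV hdV dW hdW νN (f s) (κ : HA L e dV hdV dW hdW) = ∑ i ∈ I κ, A κ i s * ∏ v ∈ TF κ, (c κ v s * N κ i v s)) :
    ∃ Ec₈ : ℂ → HA L e dV hdV dW hdW → ℂ,
      (∀ h : HA L e dV hdV dW hdW, DifferentiableOn ℂ (fun s => Ec₈ s h) {s : ℂ | 0 < s.re}) ∧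
      (∀ s : ℂ, 0 < s.re → Continuous (Ec₈ s)) ∧
      (∀ (s : ℂ) (h : HA L e dV hdV dW hdW), (n : ℝ) / 2 < s.re →
        Ec₈ s h = (s - 1 / 2) * intertwiningDelta L e dV hdV dW hdW νN (f s) h) ∧
      (∀ z : ℂ, 0 < z.re → ∃ C A ρ : ℝ, 0 < ρ ∧ ∀ s : ℂ, dist s z < ρ → ∀ h : HA L e dV hdV dW hdW,
        ‖Ec₈ s h‖ ≤ C * adelicHeightGL (n + n) L (h : GL (Fin (n + n)) (AdeleRing (𝓞 L) L)) ^ A) := by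
  obtain ⟨E, hEd, hEeq⟩ := exists_bigCell_continuation_cm_of_facesSum L e dV hdV dW hdW hn hdV0 hdW0 𝒦 νN χ hstd S P hPS I TF q hq A hA c hc N hN hB
  exact exists_bigCell_termPackage_cm' L e dV hdV dW hdW hn hdV0 hdW0 𝒦 νN χ hχ f hstd hcont hS hur E hEd hEeq

end Summit.HodgeConjecture.HodgeConjecture.Cruxes.HLiu418.K2LiuBigCellContinuationOfFacesSum

end
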